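import Summits.CriticalPhenomena.PercolationContinuityZ3.Theorems.Transplant.SkelPhiFaceDataNHistS
import Summits.CriticalPhenomena.PercolationContinuityZ3.Theorems.Transplant.SkelPhiFaceDataNHist
import Summits.CriticalPhenomena.PercolationContinuityZ3.Theorems.Transplant.SkelNeg1ChoiceO
import Summits.CriticalPhenomena.PercolationContinuityZ3.Theorems.Transplant.SkelPhiFaceResidueF
import Summits.CriticalPhenomena.PercolationContinuityZ3.Theorems.Transplant.SkelPhiFaceOblN
import Literature.Probability.Percolation.OrientedHistorySiteRenormalizationRun
import Summits.CriticalPhenomena.PercolationContinuityZ3.Theorems.Transplant.SkelPhiCellsWeakGLevelsS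
import Summits.CriticalPhenomena.PercolationContinuityZ3.Theorems.Transplant.SkelPhiCellsWeakGS
import Summits.CriticalPhenomena.PercolationContinuityZ3.Theorems.Transplant.SkelPhiFaceDataNS
import Summits.CriticalPhenomena.PercolationContinuityZ3.Theorems.Transplant.KNCells2SchemeO
import Summits.CriticalPhenomena.PercolationContinuityZ3.Theorems.Transplant.KNCellsSchemeO
import Summits.CriticalPhenomena.PercolationContinuityZ3.Theorems.Transplant.PlanarCells2SDefs
import HarnessLib
/-!
# N2 (frames-only node `SamePDropOfSkeletonFrm₁`, OPEN) — WAVE 1, (F) face-data column over STAGGERED cells ((R-22) `PCells2S`, (R-28)(β) one landing per file): the twin of N1's `SkelPhiFaceOblN`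

builds on p205010 (kernel theorem, internal audit signed; external expert review pending) — nothing in this file uses p205010; NOTHING is claimed about the
open node `SamePDropOfSkeletonFrm₁` (`SamePDropOfSkeletonNeg₁` is CLOSED in the tree and untouched by this file).
Status sentence (coordinator 2026-08-20T04:30Z): "θ(p_c) = 0 on ℤ^d, all d ≥ 2 — kernel-verified (Lean 4/Mathlib, standard axioms); internal adversarial
audit SIGNED 2026-08-20 04:29Z; external expert review pending."
Lane `prim-bschramm`, seat `prim-hp-8` (gen 40); helper file (`--supports stmt-CriticalPhenomena-4575 --as helper`); design owner p3-g15 ((R-22) staggered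
cells `PCells2S`, (R-27)/(R-29) far regions of record `FarNS/FarNS₂`, (R-28)(β), naming 2026-08-22T23:00:04Z: suffix `S`).
PORT RULES (HOME/prim-hp-8/code/gen40/orient/bin/port_s.py = stmt-g19's port_orient.py + the G token table): the cells are `P : PCells2S`, every box is
read about the STAGGERED centre `cenS` (`PlanarCells2SDefs/SFar/ContainS/SArm/SepS/SepInfS/LevelsS/EfarN2S`), the scheme record is `cellGeomSG₂S`/`cellGeomSG₂bS`
(`SkelPhiCellsWeakGS/…SmallMS`: narrow arm `BtwNS`, two-block far region `FarNS₂`), the history-site API is the ORIENTED one at `qNE` where it occurs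
(`ochoice qNE`, `onwardO`, `Valid₂O`, `IsRun₂O`, …, (R-18)); EVERY declaration is re-declared with the suffix `S` (same namespace). Docstrings/citations are N1's.
N1 HEADER (kept for the reader):
* **`faceOblAt_fineN`**, **`faceOblAtM_fineN`** (`Skelφ.FaceOblAtMF G S (faceDataSG …) Δ' δ₂ h e a a' du j o`, the interface of record p282003).
[cite: KozmaNitzan2024, §4 p. 27 ((30)), p. 30 (Step III), Lemma 10 (p. 17), Lemma 12 (p. 24)] [cite: MartineauSevero2019, Cor. 2.2]
-/
noncomputable section

open MeasureTheory
open scoped Classical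

namespace Summit.CriticalPhenomena.PercolationContinuityZ3.Theorems.Transplant

namespace Skelφ

open Literature.Probability.Percolation Literature.Probability.LatticeModels SimpleGraph KNCells KNLevels GadgetSystem Contour
open Literature.Probability.Percolation.KozmaNitzan
open Literature.Probability.Percolation.KozmaNitzan.Cells (oth oth_ne sgOf sgOf_sign stepVec_apply_fst stepVec_apply_oth eq_oth_of_ne oth_oth)
open Literature.Barriers.CriticalPhenomena (graphBall graphBall_finite mem_graphBall_self graphBall_mono)
open BoxProdZ2 (ConcRadiiG)
open Skel (winGraph WinStepData excess)

variable {V : Type} [DecidableEq V] [Countable V] {G : SimpleGraph V} [G.LocallyFinite]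
variable {pr : FinePrm} {φ : V → Site 2} {P : PCells2S} {w₀ : V} {Λ : ConcRadiiG} {b : Fin 2} {S : KSchA V ℕ}
variable (hΓ : S.Γ = cellGeomSG₂S G (pr.ψ φ w₀) P w₀ Λ) (hΛ : WFS2 P.toPCells2 Λ)
variable {h : ProbeHistory V} {e : Site 2 × MDir} (hV : S.Valid₂O G h e) {a a' : ℕ} {du : MDir} (hdu : du ∈ S.onwardO G h (tgt e))
variable {j : ℕ} {o : Finset (Sym2 V)}

include hΓ hΛ hV hdu

/-- **`FaceOblAt` over the face's frame for the fine-cell geometry of record, modulo the per-level kit clause.**  The step is `Skelφ.faceStepWNS`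
(window depth `rE_{a'}(x,du)`, frame levels about the face box `[loNS, hiNS]`, region the frame window over `DplNS` inside the cell-map window over
`farAS₂`, target `M_{a'}(x+du) ∪ Rim`, levels `[M+1, Rlev]`, source the root, support `Sx`); every non-kit clause is discharged by parts 2–3.
[cite: KozmaNitzan2024, §4 p. 30 (Step III), Lemma 10 (p. 17), Lemma 12 (p. 24)] -/
theorem faceOblAt_fineNS (hlipψ : Lip G (pr.ψ φ w₀)) (hws : WeakSteps G (pr.ψ φ w₀)) (hlipF : Lip G (pr.frame φ w₀ du.1 b))
    (hc₀ : 0 < pr.c₀) (hc₁ : 0 < pr.c₁) (hD : 0 < pr.D) (hM : pr.A * TwoAxis.Para.modulus pr.n pr.h pr.vα pr.vβ ≠ 0)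
    (hnz : pr.lvGen du.1 b ≠ 0) (hjK : j + 1 ≤ P.K) {Δ' Rlev N M L' : ℕ} {δ₂ : ℝ} {pc : ℤ} {aw : ℕ} {yF : V}
    (hyF : pr.ψ φ w₀ yF = P.faceCen (tgt e) du j) (hpc : pc = relφ φ w₀ yF b)
    (hRlev : Rlev + 4 ≤ 10 * P.s du.1) (hRlev' : (Rlev : ℤ) + 5 + P.c du.1 ≤ 3 * P.r (oth du.1))
    {k₀ : ℤ} (hk₀ : pr.rdN du.1 b ≤ pr.rdK du.1 b * k₀) (hk₀' : 3 * (P.r (oth du.1) : ℤ) + k₀ + 3 ≤ 5 * P.r (oth du.1))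
    {kF : ℤ} (hroomF : pr.Mabs * (aw + Rlev + 1) + pr.rdN du.1 b * (Rlev + 2) * pr.D ≤ pr.rdK du.1 b * kF * pr.D)
    (hkF : kF + 3 + P.c du.1 ≤ 5 * P.r (oth du.1))
    (haw : (pr.rdK 1 b * (P.faceExt du 0 + 1) + pr.rdK 0 b * (P.faceExt du 1 + 1)) * pr.D ≤ pr.Mabs * (aw + 1))
    (hcount : 1 / (1 - (S.p : ℝ)) ^ (Δ' * N) ≤ δ₂ * ((Finset.Icc (M + 1) Rlev).card : ℝ))
    (hMne : (S.Γ.M a' (tgt e + stepVec du)).Nonempty)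
    (hkits : let Q := faceStepWNS G pr φ P w₀ Λ b a' (tgt e) du j pc aw Rlev N M L' (S.Sx G h e a a' du)
      ∀ j' ∈ Finset.Icc Q.j₀ Q.j₁, ∃ (σ : KNLevels.SData V) (Sz : Finset V),
                                     KNLevels.SHyp (winLData G (pr.frame φ w₀ du.1 b) Q.root Q.Rπ Q.lo Q.hi Q.root Q.Sfin) j' σ ∧ σ.N ≤ Q.N ∧
                                     (1 - (S.p : ℝ) ^ σ.sB) ^ σ.k ≤ δ₂ ∧ Sz ⊆ stepRg G (pr.frame φ w₀ du.1 b) Q ∧ (∀ x ∈ σ.K, σ.face x ⊆ Sz) ∧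
                                     KNLevels.RelayClause (winLData G (pr.frame φ w₀ du.1 b) Q.root Q.Rπ Q.lo Q.hi Q.root Q.Sfin) (S.Wt G h e a a' du j o) j' σ Sz Q.T
                                       (stepRg G (pr.frame φ w₀ du.1 b) Q) δ₂)
    {R₀ : ℕ} (hQ : Λ.rQ a (tgt e) ≤ R₀) (hρ : ∀ ℓ, Λ.ρ a' (tgt e) du ℓ ≤ R₀) {η : ℝ} (hη : η ≤ S.δc / 2)
    {φ' : V → Site 2} {m R₁ : ℕ}
    (hR₁ : ∀ R', R₁ ≤ R' → ∀ (Rw : ℕ) (D' A' : Finset V), (∀ d ∈ D', d ∈ graphBall G w₀ Rw) →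
      (∀ d ∈ D', ∀ d' ∈ D', φ' d - φ' d' ∈ box 2 m) → A' ⊆ D' → (∀ a ∈ A', a ∈ graphBall G w₀ (R₀ + 1)) →
        (bondPercolation G S.p).real (excess G w₀ R' D' A') ≤ η)
    (hR : R₁ ≤ Λ.rM a' (tgt e + stepVec du) - L')
    (hdiam : ∀ d ∈ S.Γ.Efar a' (tgt e) du, ∀ d' ∈ S.Γ.Efar a' (tgt e) du, φ' d - φ' d' ∈ box 2 m) :
    FaceOblAtF G (pr.frame φ w₀ du.1 b) S (faceDataSGS G (pr.ψ φ w₀) P w₀ Λ) Δ' δ₂ h e a a' du j o := by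
  have hexc := rim_excess_faceStepWNS hΓ hΛ hV hdu (j := j) (o := o) pc aw Rlev N M L' (b := b) hlipψ hws hjK hQ hρ hR₁ hR hdiam
  have hsub := isSubbox_faceStepWNS hΓ hΛ hV hdu (a := a) (a' := a') (j := j) (o := o) pc aw Rlev N M L' (b := b) hlipψ hws hjK
  have hRgS := faceStepWN_Rg_subset_SfinS hΓ hΛ (h := h) (e := e) (a := a) (a' := a') (du := du) (j := j) pc aw Rlev N M L' (b := b) hlipψ hws
  have hroot := faceStepWN_root_eqS hΓ (h := h) (e := e) (a := a) (a' := a') (du := du) (j := j) pc aw Rlev N M L' (b := b)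
  have ho := root_not_mem_faceStepWN_RgS hΓ hΛ hV hdu (a := a) (a' := a') (j := j) pc aw Rlev N M L' (b := b) hlipψ hws
  have hoS := root_mem_faceStepWN_SfinS (pr := pr) (φ := φ) hV (P := P) (w₀ := w₀) (Λ := Λ) (b := b) (a := a) (a' := a') (du := du)
    (j := j) pc aw Rlev N M L'
  obtain ⟨Γ, p, δc⟩ := S
  cases hΓ
  refine ⟨faceStepWNS G pr φ P w₀ Λ b a' (tgt e) du j pc aw Rlev N M L' (KSchA.Sx G ⟨cellGeomSG₂S G (pr.ψ φ w₀) P w₀ Λ, p, δc⟩ h e a a' du),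
    (cellGeomSG₂S G (pr.ψ φ w₀) P w₀ Λ).M a' (tgt e + stepVec du), η, hroot, hsub, finSupp_faceStepWNS pc aw Rlev N M L', hRgS,
    faceStepWN_enclS G φ P w₀ Λ a' hyF hpc hjK hRlev hRlev' hc₀ hc₁ hD hnz hroomF hkF N M L' _, ho, hoS, le_rfl,
    faceStepWN_T_subset_RgS G φ P w₀ a' pc aw Rlev N M L' _ hΛ.toWF2 (by omega) hlipF hc₀ hc₁ hD hnz hk₀ hk₀',
    faceStepWN_T_nonemptyS G pr φ P w₀ Λ b a' (tgt e) du j pc aw Rlev N M L' _ hMne,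
    hcount, hkits, Finset.subset_union_left, subset_rfl, hexc, hη, ?_⟩
  exact Face_subset_faceStepWN_X_zeroS G φ P w₀ a' hΛ.toWF2 hyF hpc hM hc₀ hc₁ hD haw Rlev N M L' _

/-- **The face obligation with the window map chosen per face** (p3-g8's `FaceOblAtM`, p282003), witnessed by the face's frame
`pr.frame φ w₀ du.1 b`. [cite: KozmaNitzan2024, §4 p. 30 (Step III)] -/
theorem faceOblAtM_fineNS (hlipψ : Lip G (pr.ψ φ w₀)) (hws : WeakSteps G (pr.ψ φ w₀)) (hlipF : Lip G (pr.frame φ w₀ du.1 b))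
    (hc₀ : 0 < pr.c₀) (hc₁ : 0 < pr.c₁) (hD : 0 < pr.D) (hM : pr.A * TwoAxis.Para.modulus pr.n pr.h pr.vα pr.vβ ≠ 0)
    (hnz : pr.lvGen du.1 b ≠ 0) (hjK : j + 1 ≤ P.K) {Δ' Rlev N M L' : ℕ} {δ₂ : ℝ} {pc : ℤ} {aw : ℕ} {yF : V}
    (hyF : pr.ψ φ w₀ yF = P.faceCen (tgt e) du j) (hpc : pc = relφ φ w₀ yF b)
    (hRlev : Rlev + 4 ≤ 10 * P.s du.1) (hRlev' : (Rlev : ℤ) + 5 + P.c du.1 ≤ 3 * P.r (oth du.1))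
    {k₀ : ℤ} (hk₀ : pr.rdN du.1 b ≤ pr.rdK du.1 b * k₀) (hk₀' : 3 * (P.r (oth du.1) : ℤ) + k₀ + 3 ≤ 5 * P.r (oth du.1))
    {kF : ℤ} (hroomF : pr.Mabs * (aw + Rlev + 1) + pr.rdN du.1 b * (Rlev + 2) * pr.D ≤ pr.rdK du.1 b * kF * pr.D)
    (hkF : kF + 3 + P.c du.1 ≤ 5 * P.r (oth du.1))
    (haw : (pr.rdK 1 b * (P.faceExt du 0 + 1) + pr.rdK 0 b * (P.faceExt du 1 + 1)) * pr.D ≤ pr.Mabs * (aw + 1))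
    (hcount : 1 / (1 - (S.p : ℝ)) ^ (Δ' * N) ≤ δ₂ * ((Finset.Icc (M + 1) Rlev).card : ℝ))
    (hMne : (S.Γ.M a' (tgt e + stepVec du)).Nonempty)
    (hkits : let Q := faceStepWNS G pr φ P w₀ Λ b a' (tgt e) du j pc aw Rlev N M L' (S.Sx G h e a a' du)
      ∀ j' ∈ Finset.Icc Q.j₀ Q.j₁, ∃ (σ : KNLevels.SData V) (Sz : Finset V),
                                     KNLevels.SHyp (winLData G (pr.frame φ w₀ du.1 b) Q.root Q.Rπ Q.lo Q.hi Q.root Q.Sfin) j' σ ∧ σ.N ≤ Q.N ∧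
                                     (1 - (S.p : ℝ) ^ σ.sB) ^ σ.k ≤ δ₂ ∧ Sz ⊆ stepRg G (pr.frame φ w₀ du.1 b) Q ∧ (∀ x ∈ σ.K, σ.face x ⊆ Sz) ∧
                                     KNLevels.RelayClause (winLData G (pr.frame φ w₀ du.1 b) Q.root Q.Rπ Q.lo Q.hi Q.root Q.Sfin) (S.Wt G h e a a' du j o) j' σ Sz Q.T
                                       (stepRg G (pr.frame φ w₀ du.1 b) Q) δ₂)
    {R₀ : ℕ} (hQ : Λ.rQ a (tgt e) ≤ R₀) (hρ : ∀ ℓ, Λ.ρ a' (tgt e) du ℓ ≤ R₀) {η : ℝ} (hη : η ≤ S.δc / 2)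
    {φ' : V → Site 2} {m R₁ : ℕ}
    (hR₁ : ∀ R', R₁ ≤ R' → ∀ (Rw : ℕ) (D' A' : Finset V), (∀ d ∈ D', d ∈ graphBall G w₀ Rw) →
      (∀ d ∈ D', ∀ d' ∈ D', φ' d - φ' d' ∈ box 2 m) → A' ⊆ D' → (∀ a ∈ A', a ∈ graphBall G w₀ (R₀ + 1)) →
        (bondPercolation G S.p).real (excess G w₀ R' D' A') ≤ η)
    (hR : R₁ ≤ Λ.rM a' (tgt e + stepVec du) - L')
    (hdiam : ∀ d ∈ S.Γ.Efar a' (tgt e) du, ∀ d' ∈ S.Γ.Efar a' (tgt e) du, φ' d - φ' d' ∈ box 2 m) :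
    FaceOblAtMF G S (faceDataSGS G (pr.ψ φ w₀) P w₀ Λ) Δ' δ₂ h e a a' du j o :=
  ⟨pr.frame φ w₀ du.1 b, hlipF, faceOblAt_fineNS hΓ hΛ hV hdu hlipψ hws hlipF hc₀ hc₁ hD hM hnz hjK hyF hpc hRlev hRlev' hk₀ hk₀' hroomF hkF
    haw hcount hMne hkits hQ hρ hη hR₁ hR hdiam⟩

end Skelφ

end Summit.CriticalPhenomena.PercolationContinuityZ3.Theorems.Transplant

end
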